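import Mathlib
import Summits.MatrixMultiplication.Statement
import Summits.MatrixMultiplication.MatrixMultiplication.Theorems.GraphEquationsIsolationLocus
import Summits.MatrixMultiplication.MatrixMultiplication.Theorems.GraphEquationsIsolationOpenAlgebra

/-!
# GraphEquations — GENERIC OPENNESS OF THE TRIVIAL-FIBRE LOCUS; rung `K = 2` closed (M18f-3, decomp-mm-lens-5 g31)

(supports `MultiplicityReduction`, stmt-MatrixMultiplication-27806, hand 1 = BOP′ at `K = 2`.)

Proof of **`isoLocusOpen : IsoLocusOpen`**, hence **`isolationAtMaxRank : IsolationAtMaxRank`** (B3)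
and the UNCONDITIONAL rung `K = 2` of bounded-order purification
**`boundedOrderPurification_two : ∀ β ≥ 2, EqAdmissibleIdealIso β 2 → ∀ β' > β, EqAdmissiblePure β'`**.

The argument, for forms `H_o ∈ ℂ[y][F]` homogeneous in `F` of degree `d_o` with trivial fibre at `y₀`:
* (companion file) some degree `N ≥ max d_o` has ALL monomials of degree `N` in the ideal of the
  specialised forms at `y₀`, with homogeneous multipliers;
* `mulMatrix H d N` — the degree-`N` multiplication matrix over `ℂ[y]` (rows: monomials of degree `N`,
  indexed by `ExpIdx`; columns: pairs `(o, monomial of degree N - d_o)`); it specialises entrywise;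
* `exists_mulVec_eq_single` / `monomial_mem_span_of_mulVec` — "every degree-`N` monomial is in the
  ideal" ⟺ "every unit vector is in the column space of the specialised matrix";
* so the matrix has full row rank at `y₀` (`rank_eq_card_of_forall_single`), a maximal minor `g` with
  `g(y₀) ≠ 0` (`exists_submatrix_det_ne_zero`), and wherever `g(y) ≠ 0` the unit vectors are again
  in the column space (`exists_mulVec_eq_of_det_ne_zero`, Cramer), so all degree-`N` monomials lie in
  the ideal at `y` and the fibre is trivial (`trivialZero_of_monomials_mem`).

No `sorry`.  Sources: [CoxLittleOShea2015, Ch. 8 §5, Thm 6 (projective extension theorem)].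
-/

set_option linter.dupNamespace false

noncomputable section

open scoped BigOperators

namespace Summit.MatrixMultiplication.MatrixMultiplication.Theorems.GraphEquations

open MvPolynomial GraphEquations
open Literature.Computability.AlgebraicComplexity

/-! ## Linear algebra: full row rank and solving along a non-vanishing maximal minor -/

section linalg

variable {m' n' K : Type*} [Fintype n'] [Field K]

/-- `(M v)_i = ∑_j M_ij v_j`. -/
theorem mulVec_eq_sum {R : Type*} [NonUnitalNonAssocSemiring R] (M : Matrix m' n' R) (v : n' → R)
    (i : m') : M.mulVec v i = ∑ j, M i j * v j := rfl

/-- If every unit vector is in the column space, the rank is the number of rows. -/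
theorem rank_eq_card_of_forall_single [Fintype m'] [DecidableEq m'] (A : Matrix m' n' K)
    (h : ∀ i, ∃ x : n' → K, A.mulVec x = Pi.single i 1) : A.rank = Fintype.card m' := by
  classical
  choose x hx using h
  have hsurj : Function.Surjective A.mulVecLin := by
    intro v
    refine ⟨∑ i, v i • x i, ?_⟩
    rw [map_sum]
    simp_rw [map_smul, Matrix.mulVecLin_apply, hx]
    funext j
    simp [Finset.sum_apply, Pi.single_apply]
  unfold Matrix.rank
  rw [LinearMap.range_eq_top.mpr hsurj, finrank_top, Module.finrank_fintype_fun_eq_card]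

/-- **Cramer along a maximal minor.**  If an `r × r` submatrix with `r ≥ #rows` has non-zero
determinant, every right-hand side is in the column space. -/
theorem exists_mulVec_eq_of_det_ne_zero [Fintype m'] [DecidableEq n'] (A : Matrix m' n' K) {r : ℕ}
    (hr : Fintype.card m' ≤ r) (e : Fin r → m') (f : Fin r → n')
    (h : (A.submatrix e f).det ≠ 0) (b : m' → K) : ∃ x : n' → K, A.mulVec x = b := by
  classical
  have hinj : Function.Injective e := by
    intro i j hij
    by_contra hne
    exact h (Matrix.det_zero_of_row_eq hne (funext fun l => by simp [Matrix.submatrix_apply, hij]))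
  have hsurj : Function.Surjective e := by
    have h1 : r ≤ Fintype.card m' := by simpa using Fintype.card_le_of_injective e hinj
    have hcard : Fintype.card (Fin r) = Fintype.card m' := by
      rw [Fintype.card_fin]
      omega
    exact ((Fintype.bijective_iff_injective_and_card e).mpr ⟨hinj, hcard⟩).2
  have hS : IsUnit (A.submatrix e f).det := isUnit_iff_ne_zero.mpr h
  let c : Fin r → K := (A.submatrix e f)⁻¹.mulVec fun i => b (e i)
  have hSc : (A.submatrix e f).mulVec c = fun i => b (e i) := by
    simp only [c, Matrix.mulVec_mulVec, Matrix.mul_nonsing_inv _ hS, Matrix.one_mulVec]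
  refine ⟨fun l => ∑ j, if f j = l then c j else 0, ?_⟩
  funext i0
  obtain ⟨i, rfl⟩ := hsurj i0
  rw [← congrFun hSc i, mulVec_eq_sum, mulVec_eq_sum]
  calc ∑ l, A (e i) l * (∑ j, if f j = l then c j else 0)
        = ∑ l, ∑ j, (if f j = l then A (e i) l * c j else 0) := by
          simp_rw [Finset.mul_sum, mul_ite, mul_zero]
    _ = ∑ j, ∑ l, (if f j = l then A (e i) l * c j else 0) := Finset.sum_comm
    _ = ∑ j, (A.submatrix e f) i j * c j := by
          simp_rw [Finset.sum_ite_eq, if_pos (Finset.mem_univ _), Matrix.submatrix_apply]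

end linalg

/-! ## Monomials of bounded exponents as a finite index type -/

section expidx

variable {κ : Type*} [Fintype κ]

/-- Exponent vectors with entries `≤ N` and total degree `k` (a finite index type for the monomials
of degree `k ≤ N`). -/
abbrev ExpIdx (κ : Type*) [Fintype κ] (N k : ℕ) : Type _ :=
  {g : κ → Fin (N + 1) // (∑ q, (g q : ℕ)) = k}

/-- The exponent vector (as a finitely supported function) of an index. -/
def expMon {N k : ℕ} (g : ExpIdx κ N k) : κ →₀ ℕ :=
  Finsupp.equivFunOnFinite.symm fun q => (g.1 q : ℕ)

/-- Entries of `expMon`. -/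
@[simp] theorem expMon_apply {N k : ℕ} (g : ExpIdx κ N k) (q : κ) : expMon g q = g.1 q := rfl

/-- `expMon g` has degree `k`. -/
theorem degree_expMon {N k : ℕ} (g : ExpIdx κ N k) : (expMon g).degree = k := by
  rw [Finsupp.degree_eq_sum]
  simp only [expMon_apply]
  exact g.2

/-- `expMon` is injective. -/
theorem expMon_injective {N k : ℕ} : Function.Injective (expMon : ExpIdx κ N k → κ →₀ ℕ) := by
  intro g g' h
  apply Subtype.ext
  funext q
  apply Fin.ext
  have := congrArg (fun m : κ →₀ ℕ => m q) h
  simpa using this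

/-- Every exponent vector of degree `k ≤ N` is an `expMon`. -/
theorem exists_expMon_eq {m : κ →₀ ℕ} {N k : ℕ} (hm : m.degree = k) (hk : k ≤ N) :
    ∃ g : ExpIdx κ N k, expMon g = m := by
  have hle : ∀ q, m q ≤ N := fun q => (Finsupp.le_degree q m).trans (hm.le.trans hk)
  refine ⟨⟨fun q => ⟨m q, Nat.lt_succ_of_le (hle q)⟩, ?_⟩, ?_⟩
  · simp only
    rw [← hm, Finsupp.degree_eq_sum]
  · ext q
    simp

/-- Expansion of a form of degree `k ≤ N` in the monomials indexed by `ExpIdx κ N k`. -/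
theorem eq_sum_expMon [DecidableEq κ] {R : Type*} [CommSemiring R] (b : MvPolynomial κ R) {N k : ℕ}
    (hb : b.IsHomogeneous k) (hk : k ≤ N) :
    b = ∑ g : ExpIdx κ N k, coeff (expMon g) b • monomial (expMon g) (1 : R) := by
  classical
  apply MvPolynomial.ext
  intro m
  rw [coeff_sum]
  simp_rw [coeff_smul, coeff_monomial, smul_eq_mul, mul_ite, mul_one, mul_zero]
  by_cases hm : m.degree = k
  · obtain ⟨g, rfl⟩ := exists_expMon_eq hm hk
    rw [Finset.sum_eq_single g]
    · rw [if_pos rfl]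
    · intro g' _ hne
      rw [if_neg fun h => hne (expMon_injective h)]
    · intro h
      exact absurd (Finset.mem_univ g) h
  · rw [hb.coeff_eq_zero hm]
    symm
    refine Finset.sum_eq_zero fun g _ => ?_
    rw [if_neg]
    intro h
    apply hm
    rw [← h]
    exact degree_expMon g

/-! ## The degree-`N` multiplication matrix -/

/-- The degree-`N` MULTIPLICATION MATRIX of the family `H` with degrees `d`: the entry at row `ρ`
(a monomial of degree `N`) and column `(o, g)` (`g` a monomial of degree `N - d_o`) is the
coefficient of `X^ρ` in `X^g · H_o`. -/
def mulMatrix {R ι : Type*} [CommSemiring R] (H : ι → MvPolynomial κ R) (d : ι → ℕ) (N : ℕ) :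
    Matrix (ExpIdx κ N N) ((o : ι) × ExpIdx κ N (N - d o)) R :=
  Matrix.of fun ρ c => coeff (expMon ρ) (monomial (expMon c.2) 1 * H c.1)

/-- The multiplication matrix specialises entrywise. -/
theorem mulMatrix_map {R S ι : Type*} [CommSemiring R] [CommSemiring S] (f : R →+* S)
    (H : ι → MvPolynomial κ R) (d : ι → ℕ) (N : ℕ) :
    (mulMatrix H d N).map f = mulMatrix (fun o => map f (H o)) d N := by
  ext ρ c
  rw [Matrix.map_apply, mulMatrix, mulMatrix, Matrix.of_apply, Matrix.of_apply, ← coeff_map, map_mul,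
    map_monomial, map_one]

variable {ι : Type*} [Fintype ι]

/-- Column space ⇒ ideal: if the unit vector at `ρ` is in the column space of the specialised
multiplication matrix, the monomial `X^ρ` lies in the ideal of the forms. -/
theorem monomial_mem_span_of_mulVec [DecidableEq κ] (P : ι → MvPolynomial κ ℂ) (d : ι → ℕ)
    (hP : ∀ o, (P o).IsHomogeneous (d o)) {N : ℕ} (hdN : ∀ o, d o ≤ N) (ρ : ExpIdx κ N N)
    (lam : ((o : ι) × ExpIdx κ N (N - d o)) → ℂ) (hlam : (mulMatrix P d N).mulVec lam = Pi.single ρ 1) :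
    monomial (expMon ρ) (1 : ℂ) ∈ Ideal.span (Set.range P) := by
  classical
  have heq : monomial (expMon ρ) (1 : ℂ) = ∑ c, lam c • (monomial (expMon c.2) 1 * P c.1) := by
    apply MvPolynomial.ext
    intro m
    rw [coeff_monomial, coeff_sum]
    simp_rw [coeff_smul, smul_eq_mul]
    by_cases hm : m.degree = N
    · obtain ⟨g, rfl⟩ := exists_expMon_eq hm le_rfl
      have h := congrFun hlam g
      rw [Pi.single_apply, mulVec_eq_sum] at h
      simp only [mulMatrix, Matrix.of_apply] at h
      have hite : (if expMon ρ = expMon g then (1 : ℂ) else 0) = if g = ρ then 1 else 0 := by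
        by_cases hg : g = ρ
        · rw [if_pos hg, if_pos (congrArg expMon hg.symm)]
        · rw [if_neg hg, if_neg fun h' => hg (expMon_injective h').symm]
      rw [hite, ← h]
      exact Finset.sum_congr rfl fun c _ => mul_comm _ _
    · rw [if_neg fun h : expMon ρ = m => hm (by rw [← h]; exact degree_expMon ρ)]
      symm
      refine Finset.sum_eq_zero fun c _ => ?_
      rw [((isHomogeneous_monomial (1 : ℂ) (degree_expMon c.2)).mul (hP c.1)).coeff_eq_zero
        (fun h' => hm (by rw [h']; exact Nat.sub_add_cancel (hdN c.1))), mul_zero]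
  rw [heq]
  refine Ideal.sum_mem _ fun c _ => ?_
  rw [smul_eq_C_mul, ← mul_assoc]
  exact Ideal.mul_mem_left _ _ (Ideal.subset_span (Set.mem_range_self _))

/-- Ideal ⇒ column space: if the monomial `X^ρ` lies in the ideal of the forms (`d_o ≤ N`), the unit
vector at `ρ` is in the column space of the multiplication matrix (homogeneous representation). -/
theorem exists_mulVec_eq_single [DecidableEq κ] (P : ι → MvPolynomial κ ℂ) (d : ι → ℕ)
    (hP : ∀ o, (P o).IsHomogeneous (d o)) {N : ℕ} (hdN : ∀ o, d o ≤ N) (ρ : ExpIdx κ N N)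
    (hmem : monomial (expMon ρ) (1 : ℂ) ∈ Ideal.span (Set.range P)) :
    ∃ lam : ((o : ι) × ExpIdx κ N (N - d o)) → ℂ, (mulMatrix P d N).mulVec lam = Pi.single ρ 1 := by
  classical
  obtain ⟨b, hb, hsum⟩ :=
    exists_homogeneous_repr P d hP hdN (isHomogeneous_monomial (1 : ℂ) (degree_expMon ρ)) hmem
  refine ⟨fun c => coeff (expMon c.2) (b c.1), ?_⟩
  funext ρ'
  have key : (mulMatrix P d N).mulVec (fun c => coeff (expMon c.2) (b c.1)) ρ' =
      coeff (expMon ρ') (∑ o, b o * P o) := by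
    rw [mulVec_eq_sum, Fintype.sum_sigma, coeff_sum]
    refine Finset.sum_congr rfl fun o _ => ?_
    conv_rhs => rw [eq_sum_expMon (b o) (hb o) (Nat.sub_le N (d o)), Finset.sum_mul, coeff_sum]
    refine Finset.sum_congr rfl fun g _ => ?_
    rw [mulMatrix, Matrix.of_apply, smul_mul_assoc, coeff_smul, smul_eq_mul, mul_comm]
  rw [key, hsum, coeff_monomial, Pi.single_apply]
  by_cases hρ : ρ' = ρ
  · rw [if_pos hρ, if_pos (congrArg expMon hρ.symm)]
  · rw [if_neg hρ, if_neg fun h' => hρ (expMon_injective h').symm]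

end expidx

/-! ## Generic openness -/

/-- **GENERIC OPENNESS OF THE TRIVIAL-FIBRE LOCUS** (general parameters `τ`, unknowns `κ`). -/
theorem exists_poly_trivialZero {τ κ ι : Type*} [Fintype κ] [DecidableEq κ] [Fintype ι]
    (H : ι → MvPolynomial κ (MvPolynomial τ ℂ)) (d : ι → ℕ) (hH : ∀ o, (H o).IsHomogeneous (d o))
    (y₀ : τ → ℂ) (h0 : ∀ F : κ → ℂ, (∀ o, eval F (map (eval y₀) (H o)) = 0) → F = 0) :
    ∃ g : MvPolynomial τ ℂ, eval y₀ g ≠ 0 ∧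
      ∀ y : τ → ℂ, eval y g ≠ 0 → ∀ F : κ → ℂ, (∀ o, eval F (map (eval y) (H o)) = 0) → F = 0 := by
  classical
  -- the specialised forms
  have hP : ∀ (y : τ → ℂ) o, (map (eval y) (H o)).IsHomogeneous (d o) := fun y o => (hH o).map _
  have hset : ∀ (y : τ → ℂ) (F : κ → ℂ),
      (∀ p ∈ Set.range (fun o => map (eval y) (H o)), eval F p = 0) ↔
        ∀ o, eval F (map (eval y) (H o)) = 0 :=
    fun y F => Set.forall_mem_range
  -- Step 1: a degree `N ≥ max d_o` with all monomials of degree `N` in the ideal at `y₀`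
  obtain ⟨N, hBN, hN1, hmon⟩ := exists_degree_monomials_mem (Set.range fun o => map (eval y₀) (H o))
    (fun F hF => h0 F ((hset y₀ F).mp hF)) (∑ o, d o)
  have hdN : ∀ o, d o ≤ N := fun o =>
    (Finset.single_le_sum (fun o _ => Nat.zero_le (d o)) (Finset.mem_univ o)).trans hBN
  -- Step 2: full row rank of the specialised multiplication matrix at `y₀`
  set M := mulMatrix H d N with hM
  have hMy : ∀ y : τ → ℂ, M.map (eval y) = mulMatrix (fun o => map (eval y) (H o)) d N :=
    fun y => mulMatrix_map _ _ _ _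
  have hrank : (M.map (eval y₀)).rank = Fintype.card (ExpIdx κ N N) := by
    apply rank_eq_card_of_forall_single
    intro ρ
    rw [hMy]
    exact exists_mulVec_eq_single _ d (hP y₀) hdN ρ (hmon _ (degree_expMon ρ))
  -- Step 3: a maximal minor, as a polynomial in `y`
  obtain ⟨e, f, hef⟩ := exists_submatrix_det_ne_zero (M.map (eval y₀))
  have hg : ∀ y : τ → ℂ, eval y (M.submatrix e f).det = ((M.map (eval y)).submatrix e f).det := by
    intro y
    rw [RingHom.map_det, RingHom.mapMatrix_apply, ← Matrix.submatrix_map]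
  refine ⟨(M.submatrix e f).det, by rw [hg]; exact hef, fun y hy F hF => ?_⟩
  -- Step 4: at `y` with `g(y) ≠ 0`, every degree-`N` monomial lies in the ideal of the forms at `y`
  rw [hg] at hy
  have hmonY : ∀ m : κ →₀ ℕ, m.degree = N →
      monomial m (1 : ℂ) ∈ Ideal.span (Set.range fun o => map (eval y) (H o)) := by
    intro m hm
    obtain ⟨ρ, rfl⟩ := exists_expMon_eq hm le_rfl
    obtain ⟨lam, hlam⟩ := exists_mulVec_eq_of_det_ne_zero (M.map (eval y)) hrank.ge e f hy
      (Pi.single ρ 1)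
    rw [hMy] at hlam
    exact monomial_mem_span_of_mulVec _ d (hP y) hdN ρ lam hlam
  exact trivialZero_of_monomials_mem _ hN1 hmonY F ((hset y F).mpr hF)

/-- **`IsoLocusOpen` holds.** -/
theorem isoLocusOpen : IsoLocusOpen :=
  fun _n _T H d hH _hd y₀ h0 => exists_poly_trivialZero H d hH y₀ h0

/-- **B3 — ISOLATION AT A MAX-RANK BASE holds.** -/
theorem isolationAtMaxRank : IsolationAtMaxRank :=
  isolationAtMaxRank_of_isoLocusOpen isoLocusOpen

/-- **RUNG `K = 2` OF BOUNDED-ORDER PURIFICATION (unconditional).**  Correct systems of cost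
`O(n^β)` whose test ideals are initially isolated to order `≤ 2` over some base yield PURE
(nonscalar straight-line) systems of cost `O(n^{β'})` for every `β' > β`. -/
theorem boundedOrderPurification_two :
    ∀ β : ℝ, 2 ≤ β → EqAdmissibleIdealIso β 2 → ∀ β' : ℝ, β < β' → EqAdmissiblePure β' :=
  boundedOrderPurification_two_of_isolationAtMaxRank isolationAtMaxRank

/-- The same in the `MultiplicityReduction` currency: reduced systems of every larger exponent. -/
theorem eqAdmissibleRed_of_eqAdmissibleIdealIso_two {β : ℝ} (h : EqAdmissibleIdealIso β 2) {β' : ℝ}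
    (hββ' : β < β') : EqAdmissibleRed β' :=
  eqAdmissibleRed_of_isolationAtMaxRank isolationAtMaxRank h hββ'

end Summit.MatrixMultiplication.MatrixMultiplication.Theorems.GraphEquations

end
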